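/-
Origin: expansion seat `planner-pub-hodgecm-mc-axioms-1-g14-0`, handover #W51 2026-08-20T15:53:55Z md5 4d3e6d201dc7 (PKG 43ad9896e4b2 → 4d3e6d201dc7; 213 l.; MECHANICAL (iib-R) rewrite v3.1 of the PKG file as it stands (60 token edits; rules R1x1+R2x11+RX[h₂']x35+R3x6+R8x7)) (`HOME/mc/pub-hodgecm-mc-axioms-1-g14/revendor/kit-r55/stage55/HodgeCM/Model/BallInstance.lean`, md5 4d3e6d201dc7, 213 lines);
landed by the gen-22 packager (p-g22) in gate run 55 REPLACES the earlier landed copy of `HodgeCM/Model/BallInstance.lean` (seat copy carried the packager Origin header of an earlier run (stripped)).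
-/
/-
Origin: CONSTRUCTION seat `planner-pub-hodgecm-mc-glue-1-g6-0` (unit pub-hodgecm-mc-glue-1-g6, gen 6 of mc-glue-1, node E ASSEMBLER), 2026-08-19T18:00Z — revision (§60) of `HodgeCM/Model/BallInstance.lean` for RUN 37: the (Θ-sat-≤) ORDER CASCADE (BINDER-TRIAGE §60: theta saturation in the `K`-order `Γ' ≤ Γ :↔ Γ'.K ≤ Γ.K` of the (W1) `Level`-pair root, covers `cover Γ Γ' (Level.Γ_mono h)`), forced by the K-order `Model.thetaSatOf` (theta-3-g9 t37 #C2); kit `mc/pub-hodgecm-mc-glue-1-g6/t37c-mcglue1g6.txt`; base PKG (RUN-35 bytes, glue-1 lineage). REPLACE — `ballFactsOf`: hypothesis `hsat` re-typed `(h : Γ' ≤ Γ)` + `T.cover Γ Γ' (Level.Γ_mono h)`; field `saturate` proved through `classLift_pull … (T.cover Γ Γ' (Level.Γ_mono h)) rfl (hcov Γ Γ' (Level.Γ_mono h) …)`; `hcov` keeps the `.Γ`-order (geometry). Kernel only: 0 `proof-hole`, 0 new declarations, cites nothing new; expected `#print axioms` unchanged (⊆ {propext, Classical.choice, Quot.s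ound}).
-/
/-
Origin: expansion seat `planner-pub-hodgecm-mc-period-1-g3-0`, handover #30 2026-08-19T00:20Z md5 7f88eaa1bf170bdc2bb5146cc4691b50 (NEW PKG file, 202 l.: node (P) `Model.ballOf` / `Model.ballFactsOf` — the E binders ball/ballFacts (rows 11/12) over the tree leaves (A) StandardHodgeModel p181344 + (B) UnitaryBallHolomorphicLift + (G) UnitaryBallRationalImage p181241; imports twins #25 #26 #28 #29; farm rc 0 / 0 warnings / 0 proof-hole) (`HOME/mc/pub-hodgecm-mc-period-1-g3/pkg/HodgeCM/Model/BallInstance.lean`, md5 7f88eaa1, 202 lines);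
landed by the gen-9 packager (p-g9) in gate run 33 as `HodgeCM/Model/BallInstance.lean` (verbatim).
-/
/-
Origin: construction seat `planner-pub-hodgecm-mc-period-1-g3-0` (unit pub-hodgecm-mc-period-1-g3, lineage
mc-period-1 gen 3), node (H)+(P) of the MODEL-DAG claim 2026-08-18T23:21:43Z (rows 11/12 `ball` / `ballFacts`
of `Model.perL_picardCM_r5`; ruling (P′): GROUP HALF = autform-1-g3's tree file
`UnitaryBallRationalImage.lean`, HODGE HALF = this seat's tree files `StandardHodgeModel.lean` (A) and
`UnitaryBallHolomorphicLift.lean` (B)). PKG target `HodgeCM/Model/BallInstance.lean`.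
-/
import Summits.HodgeConjecture.HodgeCM.Model.Universe
import Summits.HodgeConjecture.HodgeCM.Automorphic.ThetaWedgeSplit
import Summits.HodgeConjecture.HodgeCM.Automorphic.Realisation
import Summits.HodgeConjecture.HodgeCM.Model.Junction.SylvesterFrame
import Literature.AlgebraicGeometry.ShimuraVarieties.UnitaryBallHolomorphicLift
import Literature.AlgebraicGeometry.ShimuraVarieties.UnitaryBallRationalImage
import Literature.Geometry.ComplexHyperbolic.UnitBallIsotropy

/-!
# The ball instance of the E binders `ball` / `ballFacts` (D1-G (iii))

For the model universe `U = picardCMUniverse hHD hI h₁ h₃` and ANY theta model `T : U.ThetaModel`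
this file constructs, in kernel, the `U.BallData V c` of `HodgeCM/Automorphic/ThetaWedgeSplit.lean`

* `Pt := 𝔹²` (the tree's `BallModel.Ball`), `Gr := U(2,1)` (`BallModel.U21`) with its action,
* `Δ := ` the image in `U(2,1)` of the `L`-rational unitary group `U(V.Hm)(L)` through the Sylvester
  frame of `V` (autform-1-g3's `BallRational.ratImage`, tree `UnitaryBallRationalImage.lean`),
* `J g x := (Jac g x)ᵀ` (the canonical automorphy factor, tree `UnitBallJacobian.lean`),
* `ev Γ ω := ` the HOLOMORPHIC LIFT of the degree-one class `ω` of `P_Γ` to the ball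
  (`UnitaryBallUniformisationDatum.classLift`, tree `UnitaryBallHolomorphicLift.lean` (B), over the
  standard Hodge model of tree `StandardHodgeModel.lean` (A)), read in the UNIFORM frame
  `V.sylvesterFrame` at every level,

and proves every PRINT / INTERFACE field of `T.BallFacts V c (ballOf …)`:
`csmul contJ unitJ trans irred` (tree, ball geometry), `dense` (tree (G): Borel density input =
weak approximation at the real place), `contEv evNe wedgeDict saturate(ev-part)` (tree (A)+(B): Hodge
theory of the surface `P_Γ` + uniformisation), from exactly three hypotheses on the theta sets:
`hsub` (= the E binder `thetaSub`: theta forms are isotypic holomorphic one-forms), `hsat` (theta sets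
are saturated under the level-lowering covers — the `Theta`-part of `saturate`), `hcov` (the covers
`T.cover` commute with the uniformisations — glue-1-g3's `map_coverOf_unif` for `cover := coverOf`),
plus the ONE OPEN INPUT `htransl` = N33b (Hecke translates of theta forms are theta forms), carried
verbatim as the field `transl`.

Regime: `2 < [L:ℚ]` (then `V.Hm` is anisotropic at every level, `isAnisotropic_of_two_lt`; on the
`PerL` path `[c.K:ℚ] = 6` and `c.K ↪ L` give it, `two_lt_finrank_of_goodCtx`). No `dite`, no default
branch (J-SAN″): the hypothesis is carried.
-/

noncomputable section

open Matrix Function Set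
open scoped TensorProduct Topology
open Literature.Geometry.ComplexHyperbolic
open Literature.Geometry.ComplexHyperbolic.BallModel (U21 Ball Jac)
open Literature.AlgebraicGeometry.ShimuraVarieties
open Literature.AlgebraicGeometry.HodgeTheory
open Literature.AlgebraicGeometry.Motives (HodgeStructure bettiCohomology)
open Literature.NumberTheory.Automorphic.PicardCM

namespace HodgeCM

namespace Model

variable (hHD : exists_isReal_hodgeModel) (hI : hodgePQ_independent_of_hodgeModel)
  (h₁ : BallQuotientUniformised)  (h₃ : CMAbelianVarietyRealised)

variable {L : CMField} {ι₁ : L →+* ℂ} (V : HermSpace3 L ι₁)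

/-! ### The uniform Sylvester frame -/

/-- `Tᴴ · Hm^{ι₁} · T = J` for the chosen Sylvester frame `T = V.sylvesterFrame` of `V`. -/
theorem sylvesterFrame_J :
    (V.sylvesterFrame : Matrix (Fin 3) (Fin 3) ℂ)ᴴ * V.Hm.map ι₁ * (V.sylvesterFrame : Matrix (Fin 3) (Fin 3) ℂ) =
      BallModel.J := by
  rw [← UnitaryBallUniformisationDatum.signatureMatrix_two]; exact V.sylvesterFrame_spec'

/-- `Hm` is hermitian for the CM conjugation, in the tree's matrix form `(Hm.map c)ᵀ = Hm`. -/
theorem transpose_map_complexConj_Hm :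
    (V.Hm.map (NumberField.IsCMField.complexConj L : L →+* L))ᵀ = V.Hm :=
  Matrix.ext fun i j => V.isHermitian j i

variable {V} in
/-- The complexified Gram matrix of the ball datum under `P_Γ` is `Hm^{ι₁}` (the code of `(L, ι₁, V, Γ)`
realises `V.Hm` read in `ℂ` through `ι₁`; cf. glue-1-g3's `map_Hm_eq_ballDatum_H_map`). -/
theorem ballDatumOf_Hℂ (Γ : Level V) (hV : IsAnisotropic L V.Hm) :
    (ballDatumOf (hHD := hHD) (hI := hI) (hU := ballQuotientUniformisedDatum_of h₁) (h₃ := h₃) L ι₁ V Γ hV).Hℂ =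
      V.Hm.map ι₁ := by
  change ((pmsRealisation (ballQuotientUniformisedDatum_of h₁) (pmsCode L ι₁ V Γ)).datum
      ((isAnisotropic_pmsCode_iff L ι₁ V Γ).2 hV)).H.map
    ((pmsRealisation (ballQuotientUniformisedDatum_of h₁) (pmsCode L ι₁ V Γ)).datum
      ((isAnisotropic_pmsCode_iff L ι₁ V Γ).2 hV)).E.subtype = _
  rw [(pmsRealisation (ballQuotientUniformisedDatum_of h₁) (pmsCode L ι₁ V Γ)).datum_H]
  exact PicardCode.ofHermitian_H_map ι₁ V.Hm Γ.Γ V.isHermitian V.signature_ι₁ V.posDef_of_ne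
    Γ.isCongruence Γ.torsionFree

variable {V} in
/-- The UNIFORM Sylvester frame of the ball data under `P_Γ`: the matrix `V.sylvesterFrame`, the same
at every level `Γ` (so that level-lowering covers are read in one frame, `classLift_pull`). -/
def ballFrame (Γ : Level V) (hV : IsAnisotropic L V.Hm) :
    (ballDatumOf (hHD := hHD) (hI := hI) (hU := ballQuotientUniformisedDatum_of h₁) (h₃ := h₃) L ι₁ V Γ hV).SylvesterFrame :=
  ⟨V.sylvesterFrame, by rw [ballDatumOf_Hℂ hHD hI h₁ h₃]; exact sylvesterFrame_J V⟩

variable {V} in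
/-- (Ported verbatim from the HodgeCMPerL package; no docstring in the source.) -/
@[simp] theorem ballFrame_t (Γ : Level V) (hV : IsAnisotropic L V.Hm) :
    (ballFrame hHD hI h₁ h₃ Γ hV).t = (V.sylvesterFrame : Matrix (Fin 3) (Fin 3) ℂ) := rfl

/-! ### The regime -/

/-- On the `PerL` path the regime `2 < [L:ℚ]` holds: a good context embeds the sextic CM field `c.K`
into `L`. -/
theorem two_lt_finrank_of_goodCtx {T : (picardCMUniverse hHD hI h₁ h₃).ThetaModel} {c : SeesawCtx L}
    (hc : T.GoodCtx ι₁ c) (hK : Module.finrank ℚ c.K = 6) : 2 < Module.finrank ℚ L := by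
  obtain ⟨j, -, -⟩ := hc.forced
  have h := LinearMap.finrank_le_finrank_of_injective (f := j.toRatAlgHom.toLinearMap) j.injective
  rw [hK] at h
  omega

/-! ### The ball data -/

/-- **The ball data** of `(V, c)` on the model universe in the regime `2 < [L:ℚ]`: unit ball, `U(2,1)`,
the `L`-rational image `Δ`, the transposed Jacobian cocycle, and the holomorphic lift of classes. -/
def ballOf (c : SeesawCtx L) (hL : 2 < Module.finrank ℚ L) : (picardCMUniverse hHD hI h₁ h₃).BallData V c where
  Pt := Ball
  Gr := U21
  Δ := BallRational.ratImage L ι₁ V.Hm V.sylvesterFrame (sylvesterFrame_J V)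
  J g x := (Jac g x)ᵀ
  ev Γ ω := (ballDatumOf (hHD := hHD) (hI := hI) (hU := ballQuotientUniformisedDatum_of h₁) (h₃ := h₃) L ι₁ V Γ
      (isAnisotropic_of_two_lt L ι₁ V Γ hL)).classLift hHD
    (ballFrame hHD hI h₁ h₃ Γ (isAnisotropic_of_two_lt L ι₁ V Γ hL)) ω

variable (c : SeesawCtx L) (hL : 2 < Module.finrank ℚ L)

/-- (Ported verbatim from the HodgeCMPerL package; no docstring in the source.) -/
@[simp] theorem ballOf_Pt : (ballOf hHD hI h₁ h₃ V c hL).Pt = Ball := rfl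
/-- (Ported verbatim from the HodgeCMPerL package; no docstring in the source.) -/
@[simp] theorem ballOf_Gr : (ballOf hHD hI h₁ h₃ V c hL).Gr = U21 := rfl
/-- (Ported verbatim from the HodgeCMPerL package; no docstring in the source.) -/
theorem ballOf_Δ : (ballOf hHD hI h₁ h₃ V c hL).Δ =
    BallRational.ratImage L ι₁ V.Hm V.sylvesterFrame (sylvesterFrame_J V) := rfl
/-- (Ported verbatim from the HodgeCMPerL package; no docstring in the source.) -/
theorem ballOf_J (g : U21) (x : Ball) : (ballOf hHD hI h₁ h₃ V c hL).J g x = (Jac g x)ᵀ := rfl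
/-- (Ported verbatim from the HodgeCMPerL package; no docstring in the source.) -/
theorem ballOf_ev (Γ : Level V) (ω) : (ballOf hHD hI h₁ h₃ V c hL).ev Γ ω =
    (ballDatumOf (hHD := hHD) (hI := hI) (hU := ballQuotientUniformisedDatum_of h₁) (h₃ := h₃) L ι₁ V Γ
      (isAnisotropic_of_two_lt L ι₁ V Γ hL)).classLift hHD
    (ballFrame hHD hI h₁ h₃ Γ (isAnisotropic_of_two_lt L ι₁ V Γ hL)) ω := rfl

/-! ### The ball facts -/

variable (T : (picardCMUniverse hHD hI h₁ h₃).ThetaModel)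

/-- Theta forms are holomorphic: `Θ ⊆ U_Ψ(Γ) ⊆ H^{1,0} ⊆ F¹` (from `hsub` and `Fact_pull_hodge`, kernel). -/
theorem mem_F_one_of_theta
    (hsub : ∀ (i : Fin 4) (Γ : Level V), T.Theta V c i Γ ⊆
      (picardCMUniverse hHD hI h₁ h₃).Uiso Γ c.K (c.Ψ i) c.σ)
    (i : Fin 4) (Γ : Level V) (ω : (picardCMUniverse hHD hI h₁ h₃).CohC
      ((picardCMUniverse hHD hI h₁ h₃).pms L ι₁ V Γ) 1) (hω : ω ∈ T.Theta V c i Γ) :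
    ω ∈ (BettiUniverse.hodge hHD (Var.isSmoothProjective (ballQuotientUniformisedDatum_of h₁) h₃
      ((picardCMUniverse hHD hI h₁ h₃).pms L ι₁ V Γ)) 1).F 1 :=
  HodgeStructure.piece_le_F _ 1 0
    (Universe.Uiso_le_H10 (modelAxiomsPerL hHD hI h₃ h₁).pull_hodge Γ c.K (c.Ψ i) c.σ (hsub i Γ hω))

/-- **The ball facts** for `ballOf`: every field of `T.BallFacts V c (ballOf …)` in kernel from the tree,
given `hsub` (theta ⊆ isotypic), `hsat` (theta sets saturated under the covers), `hcov` (covers commute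
with the uniformisations) and the OPEN INPUT `htransl` (N33b), carried as the field `transl`. -/
theorem ballFactsOf
    (hsub : ∀ (i : Fin 4) (Γ : Level V), T.Theta V c i Γ ⊆
      (picardCMUniverse hHD hI h₁ h₃).Uiso Γ c.K (c.Ψ i) c.σ)
    (hsat : ∀ (i : Fin 4) (Γ Γ' : Level V) (h : Γ' ≤ Γ)
      (ω : (picardCMUniverse hHD hI h₁ h₃).CohC ((picardCMUniverse hHD hI h₁ h₃).pms L ι₁ V Γ) 1),
      ω ∈ T.Theta V c i Γ → (picardCMUniverse hHD hI h₁ h₃).pullC (T.cover Γ Γ' (Level.Γ_mono h)) 1 ω ∈ T.Theta V c i Γ')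
    (hcov : ∀ (Γ Γ' : Level V) (h : Γ'.Γ ≤ Γ.Γ) (hV : IsAnisotropic L V.Hm),
      ∀ v ∈ (ballDatumOf (hHD := hHD) (hI := hI) (hU := ballQuotientUniformisedDatum_of h₁) (h₃ := h₃) L ι₁ V Γ' hV).cone,
      Literature.AlgebraicGeometry.Motives.AlgPoints.map (T.cover Γ Γ' h)
          ((ballDatumOf (hHD := hHD) (hI := hI) (hU := ballQuotientUniformisedDatum_of h₁) (h₃ := h₃) L ι₁ V Γ' hV).unif v) =
        (ballDatumOf (hHD := hHD) (hI := hI) (hU := ballQuotientUniformisedDatum_of h₁) (h₃ := h₃) L ι₁ V Γ hV).unif v)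
    (htransl : ∀ γ ∈ (ballOf hHD hI h₁ h₃ V c hL).Δ, ∀ (i : Fin 4) (Γ : Level V)
      (ω : (picardCMUniverse hHD hI h₁ h₃).CohC ((picardCMUniverse hHD hI h₁ h₃).pms L ι₁ V Γ) 1),
      ω ∈ T.Theta V c i Γ → ∃ (Γ' : Level V)
        (ω' : (picardCMUniverse hHD hI h₁ h₃).CohC ((picardCMUniverse hHD hI h₁ h₃).pms L ι₁ V Γ') 1),
        ω' ∈ T.Theta V c i Γ' ∧ (ballOf hHD hI h₁ h₃ V c hL).ev Γ' ω' =
          fun x => (ballOf hHD hI h₁ h₃ V c hL).J γ x *ᵥ (ballOf hHD hI h₁ h₃ V c hL).ev Γ ω (γ • x)) :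
    T.BallFacts V c (ballOf hHD hI h₁ h₃ V c hL) where
  csmul := (inferInstance : ContinuousSMul U21 Ball)
  contJ x := BallModel.continuous_Jac_transpose x
  unitJ g x := BallModel.isUnit_Jac_transpose g x
  trans x y := BallModel.transitive x y
  dense := BallRational.dense_ratImage L ι₁ V.Hm V.sylvesterFrame (sylvesterFrame_J V)
    (transpose_map_complexConj_Hm V)
  irred x v hv := BallModel.irred x v hv
  contEv _ _ ω _ := UnitaryBallUniformisationDatum.continuous_classLift _ hHD _ ω
  transl := htransl
  evNe i Γ ω hω h0 :=
    UnitaryBallUniformisationDatum.classLift_ne_zero _ hHD _ hI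
      (mem_F_one_of_theta hHD hI h₁ h₃ V c T hsub i Γ ω hω) h0
  wedgeDict Γ ω₁ ω₂ hω₁ hω₂ hcup x :=
    UnitaryBallUniformisationDatum.wedge_classLift_eq_zero _ hHD _ hI
      (mem_F_one_of_theta hHD hI h₁ h₃ V c T hsub 0 Γ ω₁ hω₁)
      (mem_F_one_of_theta hHD hI h₁ h₃ V c T hsub 1 Γ ω₂ hω₂) hcup x
  saturate i Γ Γ' h ω hω :=
    ⟨hsat i Γ Γ' h ω hω,
      UnitaryBallUniformisationDatum.classLift_pull _ hHD _ hI _ _ (T.cover Γ Γ' (Level.Γ_mono h)) rfl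
        (hcov Γ Γ' (Level.Γ_mono h) (isAnisotropic_of_two_lt L ι₁ V Γ hL))
        (mem_F_one_of_theta hHD hI h₁ h₃ V c T hsub i Γ ω hω)⟩

end Model

end HodgeCM

end
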